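import Summits.KontsevichZagierPeriods.Zeta5Search.Denom.RecordRayBrickCore
import Summits.KontsevichZagierPeriods.Zeta5Search.Denom.RecordRayNuCells
import HarnessLib

/-!
# ζ(5) search — the record ray's BRICK CELLS: certified `ν`-cells ⇒ prime powers dividing the kernel's integers
(cell `pub-zeta5`, fam-denom 66)

HONEST FRAMING: systematic search; no irrationality claim unless certified.

OUR theorem (Summit side), the consumer-facing end of the Φ/(8.11) port:

* `nuPair_bRecord'_le` — the partner's exponent is at least the ray's: `ν(bRecord n; i, p) ≤ ν(bRecord' n; i, p)`
  whenever `p ∤ 13n` and `p ∤ 14n` (the slot-7 bump `11n ↦ 11n+1` only touches `⌊(13n−1)/p⌋`, `⌊(14n−1)/p⌋` and two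
  floors that can only grow);
* `brick_cell` — **for a certified cell `C ∈ nuCells` (bound `c`), every `n ≥ 1` and every prime `p` with
  `41 < p ≤ 41n < p²` whose ratio lies in the cell, `a₀/b₀ < n/p − m < a₁/b₁`: `p^k` divides the multiplied wedge
  `z_{W′}z_V − z_W z_{V′}` and the multiplied Q-minor `d⁵(z_U z_{W′} − z_{U′} z_W)` for every `k ≤ 2c`** — the
  hypothesis/conclusion shape of `RecordRay.cell_core`, so the kernel may use `k = max(k_cell, 2c)` on the window.

`p`-adic bookkeeping only; nothing here bears on irrationality.  0 sorry.
-/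

noncomputable section

open Finset
open Literature.NumberTheory.Transcendental

namespace Summit.KontsevichZagierPeriods.Zeta5Search

namespace Denom.RecordRayBrickCells

open DualSeries WedgeDictionary DualSeriesDenominators RecordRay Denom.DualSeriesBrickOrd Denom.RecordRayNu
  Denom.RecordRayNuCells Denom.RecordRayBrickCore
open Denom.DigitCert (Cell)
open DualSeriesLemma19 (bRecord)

/-! ### Integer-division helpers -/

/-- `⌊(z−1)/p⌋ ≤ ⌊z/p⌋`. -/
theorem pred_ediv_le (z : ℤ) {p : ℤ} (hp : 0 < p) : (z - 1) / p ≤ z / p :=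
  Int.ediv_le_ediv hp (by omega)

/-- `⌊z/p⌋ ≤ ⌊(z−1)/p⌋` when `p ∤ z`. -/
theorem ediv_le_pred_ediv {z : ℤ} {p : ℤ} (hp : 0 < p) (h : ¬ p ∣ z) : z / p ≤ (z - 1) / p := by
  have h1 := Int.emod_add_ediv_mul z p
  have h2 : z % p ≠ 0 := fun h0 => h (Int.dvd_of_emod_eq_zero h0)
  have h3 : 0 ≤ z % p := Int.emod_nonneg z hp.ne'
  have h4 : 1 ≤ z % p := by omega
  exact Int.le_ediv_of_mul_le hp (by linarith)

/-! ### The partner's exponent -/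

section Ray

variable {n p : ℕ}

/-- **`ν(bRecord n; i, p) ≤ ν(bRecord' n; i, p)`** for `p ∤ 13n`, `p ∤ 14n`. -/
theorem nuPair_bRecord'_le (hp : 0 < p) (h13 : ¬ (p : ℤ) ∣ 13 * n) (h14 : ¬ (p : ℤ) ∣ 14 * n) (i : ℕ) :
    nuPair (bRecord n) i p ≤ nuPair (bRecord' n) i p := by
  have hp' : (0 : ℤ) < p := by exact_mod_cast hp
  obtain ⟨h0, h1, h2, h3, h4, h5, h6, h7⟩ := bn_bRecord n
  have g0 := bn_bRecord'_zero n
  have g1 := bn_bRecord'_slot n (j := 1) (by norm_num) (by norm_num)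
  have g2 := bn_bRecord'_slot n (j := 2) (by norm_num) (by norm_num)
  have g3 := bn_bRecord'_slot n (j := 3) (by norm_num) (by norm_num)
  have g4 := bn_bRecord'_slot n (j := 4) (by norm_num) (by norm_num)
  have g5 := bn_bRecord'_slot n (j := 5) (by norm_num) (by norm_num)
  have g6 := bn_bRecord'_slot n (j := 6) (by norm_num) (by norm_num)
  have g7 := bn_bRecord'_seven n
  norm_num at g1 g2 g3 g4 g5 g6
  -- the four floors that change
  have f1 : (13 * (n : ℤ)) / p ≤ (13 * (n : ℤ) - 1) / p := ediv_le_pred_ediv hp' h13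
  have f2 : ((i : ℤ) - 11 * n - 1) / p ≤ ((i : ℤ) - 11 * n) / p := pred_ediv_le _ hp'
  have f3 : (14 * (n : ℤ)) / p ≤ (14 * (n : ℤ) - 1) / p := ediv_le_pred_ediv hp' h14
  have f4 : (30 * (n : ℤ) - i - 1) / p ≤ (30 * (n : ℤ) - i) / p := pred_ediv_le _ hp'
  unfold nuPair
  simp only [sum_range_succ, sum_range_zero, pfst, psnd, h0, h1, h2, h3, h4, h5, h6, h7, g0, g1, g2, g3, g4, g5,
    g6, g7]
  push_cast
  ring_nf at f1 f2 f3 f4 ⊢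
  linarith

/-! ### The brick cells -/

/-- Every certified cell lies in `(0, 1]`: `0 < a₀` and `a₁ ≤ b₁`. -/
theorem nuCells_range : ∀ C ∈ nuCells, 0 < C.a0 ∧ C.a1 ≤ (C.b1 : ℤ) := by decide +kernel

/-- A prime whose shifted ratio `n/p − m` lies strictly inside a cell of `(0,1]` does not divide `n`. -/
theorem not_dvd_of_cell {C : Cell} (hC : C ∈ nuCells) (hp : 0 < p) (m : ℕ)
    (hx0 : C.a0 * (p : ℤ) < (C.b0 : ℤ) * ((n : ℤ) - m * p)) (hx1 : (C.b1 : ℤ) * ((n : ℤ) - m * p) < C.a1 * (p : ℤ)) :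
    ¬ p ∣ n := by
  obtain ⟨ha0, ha1⟩ := nuCells_range C hC
  rintro ⟨q, rfl⟩
  push_cast at hx0 hx1
  have hp' : (0 : ℤ) < p := by exact_mod_cast hp
  have hb0 : (0 : ℤ) ≤ C.b0 := by positivity
  have hb1 : (0 : ℤ) ≤ C.b1 := by positivity
  -- `x' = q − m` is an integer strictly between `0` and `1`
  have e0 : (C.b0 : ℤ) * ((p : ℤ) * q - m * p) = (p : ℤ) * (C.b0 * ((q : ℤ) - m)) := by ring
  have e1 : (C.b1 : ℤ) * ((p : ℤ) * q - m * p) = (p : ℤ) * (C.b1 * ((q : ℤ) - m)) := by ring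
  rw [e0] at hx0; rw [e1] at hx1
  have k0 : C.a0 < C.b0 * ((q : ℤ) - m) := lt_of_mul_lt_mul_right (by linarith [hx0]) hp'.le
  have k1 : C.b1 * ((q : ℤ) - m) < C.a1 := lt_of_mul_lt_mul_right (by linarith [hx1]) hp'.le
  have hqm : 1 ≤ (q : ℤ) - m := by
    by_contra hcon
    have : C.b0 * ((q : ℤ) - m) ≤ 0 := mul_nonpos_of_nonneg_of_nonpos hb0 (by omega)
    linarith
  have : (C.b1 : ℤ) ≤ C.b1 * ((q : ℤ) - m) := le_mul_of_one_le_right hb1 hqm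
  linarith

/-- **BRICK CELL.**  For a certified cell `C` of the `ν`-table, `n ≥ 1`, a prime `41 < p ≤ 41n < p²` with
`a₀/b₀ < n/p − m < a₁/b₁`, and `k ≤ 2·c`: `p^k` divides the multiplied wedge and the multiplied Q-minor
(shape of `RecordRay.cell_core`). -/
theorem brick_cell {C : Cell} (hC : C ∈ nuCells) (hn : 1 ≤ n) (hp : p.Prime) (hp41 : 41 < p)
    (hpn : p ≤ 41 * n) (hsq : 41 * n < p ^ 2) (m : ℕ)
    (hx0 : C.a0 * (p : ℤ) < (C.b0 : ℤ) * ((n : ℤ) - m * p)) (hx1 : (C.b1 : ℤ) * ((n : ℤ) - m * p) < C.a1 * (p : ℤ))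
    {k : ℕ} (hk : (k : ℤ) ≤ 2 * C.c)
    {zW zV zW' zV' zU zU' : ℤ}
    (hzW : dRec n ^ 3 * sharpNormaliser (bRecord n) * coeffW (bRecord n) = zW)
    (hzV : dRec n ^ 6 * sharpNormaliser (bRecord n) * coeffV (bRecord n) = zV)
    (hzW' : dRec n ^ 3 * sharpNormaliser (bRecord' n) * coeffW (bRecord' n) = zW')
    (hzV' : dRec n ^ 6 * sharpNormaliser (bRecord' n) * coeffV (bRecord' n) = zV')
    (hzU : dRec n * sharpNormaliser (bRecord n) * coeffU (bRecord n) = zU)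
    (hzU' : dRec n * sharpNormaliser (bRecord' n) * coeffU (bRecord' n) = zU') :
    (p : ℤ) ^ k ∣ (zW' * zV - zW * zV') ∧
    (p : ℤ) ^ k ∣ ((Nat.lcmUpto (41 * n) : ℤ) ^ 5 * (zU * zW') - (Nat.lcmUpto (41 * n) : ℤ) ^ 5 * (zU' * zW)) := by
  have hp0 : 0 < p := hp.pos
  have hν : ∀ i, i ≤ 41 * n → C.c ≤ nuPair (bRecord n) i p := fun i _ => nu_ge_of_cell_shift hC hp0 m hx0 hx1 i
  have hnd : ¬ p ∣ n := not_dvd_of_cell hC hp0 m hx0 hx1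
  have hnd' : ∀ a : ℕ, 0 < a → a < p → ¬ (p : ℤ) ∣ (a : ℤ) * n := by
    intro a ha hap hdvd
    have : p ∣ a * n := by exact_mod_cast hdvd
    rcases (Nat.Prime.dvd_mul hp).1 this with h | h
    · exact absurd (Nat.le_of_dvd ha h) (by omega)
    · exact hnd h
  have h13 : ¬ (p : ℤ) ∣ 13 * n := by exact_mod_cast hnd' 13 (by norm_num) (by omega)
  have h14 : ¬ (p : ℤ) ∣ 14 * n := by exact_mod_cast hnd' 14 (by norm_num) (by omega)
  have hν' : ∀ i, i ≤ 41 * n → C.c ≤ nuPair (bRecord' n) i p :=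
    fun i hi => (hν i hi).trans (nuPair_bRecord'_le hp0 h13 h14 i)
  exact brick_core hn hp (by omega) hpn hsq hν hν' (by linarith) hzW hzV hzW' hzV' hzU hzU'

end Ray

end Denom.RecordRayBrickCells

end Summit.KontsevichZagierPeriods.Zeta5Search
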